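import Mathlib
import HarnessLib
import Summits.HubbardSuperconductivity.HubbardSuperconductivity.Theorems.KLProgrammeC4aPPKernelTrueEnvelope

/-!
# Route `KLProgramme` — crux C4a, S3 brick (B4) «(B4)-UMK1», «(M1)-TRUE-KERNEL» for the (U1)-LAWS INTERFACE, SIGNED partner levels: parity of the true numerator,
# `|N| ≤ 1` everywhere, `N(e,−e) = 0`, the far gradient at negative levels, and the value envelope `|N(e,u)/(e+u)| ≤ (12B₁+9)·(max e |u|)⁻¹` for ALL `u ∈ ℝ`

Cell `gate-hubbard-kl`, seat hubbard-kl-k3c3-p1 (g15; row «δμ-flow with klAngularMean constant piece»).  Continuation of `…C4aPPKernelTrueEnvelope` (memo `M1-TRUE-KERNEL.md` §7,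
caveat (b)): the (U1)-LAWS hypotheses `hK0`/`hK1` of `…C4aFoldBoxTwoSidedLaw` quantify over ALL real partner levels `u`.  In signed levels the pp kernel is
`K(e,u) = N(e,u)/(e+u)` with the SAME `N = ppTrueNumerator β Λ` (partial fractions `1/((−iω+e)(iω+u)) = [1/(−iω+e)+1/(iω+u)]/(e+u)`); it is smooth across `u = −e` because
`N(e,−e) = 0`.  This file gives the split-free VALUE envelope for all `u`:
* §1 parity: `uvWeightFn_neg_level`, `uvWeightFnD1_neg_level`, `ppTrueNumerator_neg_neg` (`N(−e,−u) = −N(e,u)`), `ppTrueNumerator_antidiag` (`N(e,−e) = 0`),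
  `ppTrueNumeratorDu_neg_neg` (`∂ᵤN(−e,−u) = ∂ᵤN(e,u)`);
* §2 `abs_ppTrueNumerator_le_one` (`|N(e,u)| ≤ 1` for all `e,u`: each half `|(2/β)ΣWW·L(ωₙ,x)| ≤ tanh(β|x|/2)/2`);
* §3 `abs_ppTrueNumeratorDu_far_le_abs` (`Λ < |u| ⟹ |∂ᵤN(e,u)| ≤ (β/4)sech²(βu/2) + Λ/u²`), `abs_ppTrueNumeratorDu_le_two_div_abs` (`⟹ ≤ 2/|u|`),
  `abs_ppTrueNumeratorDu_le_inv_max` (`0 < e`, `max e |u| < 2|v|` along the segment ⟹ … — packaged as `|∂ᵤN(e,v)| ≤ (12B₁+9)/M` whenever `M ≤ 2|v|`);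
* §4 **`abs_trueKernel_signed_le_inv_max`**: `0 < e` ⟹ `|N(e,u)/(e+u)| ≤ (12B₁+9)·(max e |u|)⁻¹` for EVERY `u ∈ ℝ` (three regimes: `|e+u| ≥ max/2` by `|N| ≤ 1`;
  `|e+u| < max/2` by the mean-value theorem from `N(e,−e) = 0` along a segment of negative levels `|v| > max/2`, gradient `≤ (12B₁+9)/max` there).
What is NOT here: the signed DERIVATIVE envelope `hK1` near `u = −e` needs `∂ᵤ²N` (not typed); away from `|e+u| < max/2` it follows from §3 and `|N| ≤ 1` as in
`…TrueEnvelope`.  Pure real analysis; nothing asserts (C), K3 or superconductivity.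
References: BGM 2006 §2.1 (2.3)–(2.5), §2.4 [cite: BenfattoGiulianiMastropietro2006]; Salmhofer 1999 §4.2.5 [cite: Salmhofer1999].
-/

noncomputable section

namespace Summit.HubbardSuperconductivity.HubbardSuperconductivity.Theorems.C4a

set_option linter.dupNamespace false -- summit = problem name (single-conjunct summit), D-0017

open Real Filter Set
open scoped Topology
open Literature.MathematicalPhysics.QuantumLattice Literature.Analysis.SpecialFunctions

/-! ## §1 Parity -/

/-- `W(ω,−x) = W(ω,x)`. [cite: Salmhofer1999, §4.2.5 (4.70)] -/
theorem uvWeightFn_neg_level (Λ ω x : ℝ) : uvWeightFn Λ ω (-x) = uvWeightFn Λ ω x := by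
  unfold uvWeightFn; rw [neg_sq]

/-- `W′(ω,−x) = −W′(ω,x)`. [cite: Salmhofer1999, §4.2.5 (4.70)] -/
theorem uvWeightFnD1_neg_level (Λ ω x : ℝ) : uvWeightFnD1 Λ ω (-x) = -uvWeightFnD1 Λ ω x := by
  unfold uvWeightFnD1; rw [neg_sq]; ring

/-- **`N(−e,−u) = −N(e,u)`** (`W` even, `L` odd in the level). [cite: BenfattoGiulianiMastropietro2006, §2.4 (2.36)] -/
theorem ppTrueNumerator_neg_neg (β Λ e u : ℝ) : ppTrueNumerator β Λ (-e) (-u) = -ppTrueNumerator β Λ e u := by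
  unfold ppTrueNumerator
  rw [← mul_neg, ← tsum_neg]
  congr 1
  refine tsum_congr fun n => ?_
  rw [uvWeightFn_neg_level, uvWeightFn_neg_level, neg_sq, neg_sq]
  ring

/-- **`N(e,−e) = 0`**: the true numerator vanishes on the anti-diagonal of signed levels, so `N/(e+u)` is smooth across `u = −e`.
[cite: BenfattoGiulianiMastropietro2006, §2.4 (2.36)] -/
theorem ppTrueNumerator_antidiag (β Λ e : ℝ) : ppTrueNumerator β Λ e (-e) = 0 := by
  unfold ppTrueNumerator
  rw [mul_eq_zero]; right
  refine (tsum_congr fun n => ?_).trans tsum_zero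
  rw [neg_sq]; ring

/-- **`∂ᵤN(−e,−u) = ∂ᵤN(e,u)`** (`W′` odd, `L′` even). [cite: BenfattoGiulianiMastropietro2006, §2.4 (2.36)] -/
theorem ppTrueNumeratorDu_neg_neg (β Λ e u : ℝ) : ppTrueNumeratorDu β Λ (-e) (-u) = ppTrueNumeratorDu β Λ e u := by
  unfold ppTrueNumeratorDu
  congr 1
  refine tsum_congr fun n => ?_
  rw [uvWeightFn_neg_level, uvWeightFn_neg_level, uvWeightFnD1_neg_level, neg_sq, neg_sq]
  ring

/-! ## §2 `|N| ≤ 1` for all signed levels -/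

/-- One half: `|(2/β)Σ W(ωₙ,a)W(ωₙ,b)·L(ωₙ,x)| ≤ 1/2` for all `a, b, x`. [cite: BenfattoGiulianiMastropietro2006, §2.1 (2.5)] -/
theorem abs_half_numerator_le {β : ℝ} (hβ : 0 < β) (Λ a b x : ℝ) :
    |2 / β * ∑' n : ℕ, uvWeightFn Λ (ppFreq β n) a * uvWeightFn Λ (ppFreq β n) b * (x / (ppFreq β n ^ 2 + x ^ 2))| ≤ 1 / 2 := by
  -- dominate by the free half at level `|x|`
  have hs : Summable fun n : ℕ => |x| / (ppFreq β n ^ 2 + |x| ^ 2) :=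
    ((summable_one_div_ppFreq_sq_add_sq hβ |x|).mul_left |x|).congr fun n => by ring
  have hv : ∑' n : ℕ, |x| / (ppFreq β n ^ 2 + |x| ^ 2) = β / 4 * Real.tanh (β * |x| / 2) := by
    simpa [ppFreq] using tsum_matsubara_lorentzian hβ |x|
  have hbd : ∀ n : ℕ, ‖uvWeightFn Λ (ppFreq β n) a * uvWeightFn Λ (ppFreq β n) b * (x / (ppFreq β n ^ 2 + x ^ 2))‖ ≤ |x| / (ppFreq β n ^ 2 + |x| ^ 2) :=
    fun n => by
      rw [Real.norm_eq_abs, abs_mul, abs_mul, sq_abs, abs_div, abs_of_pos (by have := ppFreq_pos hβ n; positivity : (0 : ℝ) < ppFreq β n ^ 2 + x ^ 2)]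
      calc |uvWeightFn Λ (ppFreq β n) a| * |uvWeightFn Λ (ppFreq β n) b| * (|x| / (ppFreq β n ^ 2 + x ^ 2)) ≤ 1 * 1 * (|x| / (ppFreq β n ^ 2 + x ^ 2)) := by
            gcongr
            · exact abs_uvWeightFn_le_one _ _ _
            · exact abs_uvWeightFn_le_one _ _ _
        _ = _ := by ring
  have ht := tsum_of_norm_bounded hs.hasSum hbd
  rw [Real.norm_eq_abs, hv] at ht
  have htanh : Real.tanh (β * |x| / 2) ≤ 1 := (Real.tanh_lt_one _).le
  rw [abs_mul, abs_of_pos (by positivity : (0 : ℝ) < 2 / β)]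
  calc 2 / β * |∑' n : ℕ, uvWeightFn Λ (ppFreq β n) a * uvWeightFn Λ (ppFreq β n) b * (x / (ppFreq β n ^ 2 + x ^ 2))| ≤ 2 / β * (β / 4 * Real.tanh (β * |x| / 2)) :=
        mul_le_mul_of_nonneg_left ht (by positivity)
    _ = Real.tanh (β * |x| / 2) / 2 := by field_simp; ring
    _ ≤ 1 / 2 := by linarith

/-- **`|N(e,u)| ≤ 1` for ALL signed levels.** [cite: BenfattoGiulianiMastropietro2006, §2.4 (2.36)] -/
theorem abs_ppTrueNumerator_le_one {β : ℝ} (hβ : 0 < β) (Λ e u : ℝ) : |ppTrueNumerator β Λ e u| ≤ 1 := by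
  have hdom : ∀ x : ℝ, Summable fun n : ℕ => |x| * (1 / (ppFreq β n ^ 2 + |x| ^ 2)) := fun x => (summable_one_div_ppFreq_sq_add_sq hβ |x|).mul_left |x|
  have hse : Summable fun n : ℕ => uvWeightFn Λ (ppFreq β n) e * uvWeightFn Λ (ppFreq β n) u * (e / (ppFreq β n ^ 2 + e ^ 2)) := by
    refine Summable.of_norm_bounded (hdom e) fun n => ?_
    rw [Real.norm_eq_abs, abs_mul, abs_mul, abs_div, abs_of_pos (by have := ppFreq_pos hβ n; positivity : (0 : ℝ) < ppFreq β n ^ 2 + e ^ 2), ← sq_abs e]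
    calc |uvWeightFn Λ (ppFreq β n) e| * |uvWeightFn Λ (ppFreq β n) u| * (|e| / (ppFreq β n ^ 2 + |e| ^ 2)) ≤ 1 * 1 * (|e| / (ppFreq β n ^ 2 + |e| ^ 2)) := by
          gcongr
          · exact abs_uvWeightFn_le_one _ _ _
          · exact abs_uvWeightFn_le_one _ _ _
      _ = |e| * (1 / (ppFreq β n ^ 2 + |e| ^ 2)) := by ring
  have hsu : Summable fun n : ℕ => uvWeightFn Λ (ppFreq β n) e * uvWeightFn Λ (ppFreq β n) u * (u / (ppFreq β n ^ 2 + u ^ 2)) := by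
    refine Summable.of_norm_bounded (hdom u) fun n => ?_
    rw [Real.norm_eq_abs, abs_mul, abs_mul, abs_div, abs_of_pos (by have := ppFreq_pos hβ n; positivity : (0 : ℝ) < ppFreq β n ^ 2 + u ^ 2), ← sq_abs u]
    calc |uvWeightFn Λ (ppFreq β n) e| * |uvWeightFn Λ (ppFreq β n) u| * (|u| / (ppFreq β n ^ 2 + |u| ^ 2)) ≤ 1 * 1 * (|u| / (ppFreq β n ^ 2 + |u| ^ 2)) := by
          gcongr
          · exact abs_uvWeightFn_le_one _ _ _
          · exact abs_uvWeightFn_le_one _ _ _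
      _ = |u| * (1 / (ppFreq β n ^ 2 + |u| ^ 2)) := by ring
  have hsplit : ppTrueNumerator β Λ e u =
      2 / β * ∑' n : ℕ, uvWeightFn Λ (ppFreq β n) e * uvWeightFn Λ (ppFreq β n) u * (e / (ppFreq β n ^ 2 + e ^ 2)) +
        2 / β * ∑' n : ℕ, uvWeightFn Λ (ppFreq β n) e * uvWeightFn Λ (ppFreq β n) u * (u / (ppFreq β n ^ 2 + u ^ 2)) := by
    unfold ppTrueNumerator
    rw [← mul_add, ← hse.tsum_add hsu]
    congr 1
    exact tsum_congr fun n => by ring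
  rw [hsplit]
  have h1 := abs_half_numerator_le hβ Λ e u e
  have h2 := abs_half_numerator_le hβ Λ e u u
  calc _ ≤ _ := abs_add_le _ _
    _ ≤ 1 / 2 + 1 / 2 := add_le_add h1 h2
    _ = 1 := by norm_num

/-! ## §3 The gradient at negative / large levels -/

/-- **Far gradient at any sign**: `Λ < |u| ⟹ |∂ᵤN(e,u)| ≤ (β/4)sech²(βu/2) + Λ/u²`. [cite: BenfattoGiulianiMastropietro2006, §2.4 (2.36)] -/
theorem abs_ppTrueNumeratorDu_far_le_abs {β Λ u : ℝ} (hβ : 0 < β) (hΛ : 0 < Λ) (hu : Λ < |u|) (e : ℝ) :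
    |ppTrueNumeratorDu β Λ e u| ≤ β / 4 * sech (β * u / 2) ^ 2 + Λ / u ^ 2 := by
  rcases le_or_gt 0 u with hu0 | hu0
  · rw [abs_of_nonneg hu0] at hu
    exact abs_ppTrueNumeratorDu_far_le hβ hΛ hu e
  · rw [abs_of_neg hu0] at hu
    have h := abs_ppTrueNumeratorDu_far_le hβ hΛ hu (-e)
    rw [ppTrueNumeratorDu_neg_neg] at h
    have hsech : sech (β * -u / 2) = sech (β * u / 2) := by rw [show β * -u / 2 = -(β * u / 2) by ring, sech_neg]
    rwa [hsech, neg_sq] at h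

/-- **`Λ < |u| ⟹ |∂ᵤN(e,u)| ≤ 2/|u|`** (`(β/4)sech²(βu/2) ≤ β e^{−β|u|}` and `β|u|e^{−β|u|} ≤ 1`; `Λ/u² ≤ 1/|u|`). [cite: BenfattoGiulianiMastropietro2006, §2.4 (2.36)] -/
theorem abs_ppTrueNumeratorDu_le_two_div_abs {β Λ u : ℝ} (hβ : 0 < β) (hΛ : 0 < Λ) (hu : Λ < |u|) (e : ℝ) :
    |ppTrueNumeratorDu β Λ e u| ≤ 2 / |u| := by
  have hu0 : 0 < |u| := hΛ.trans hu
  have h := abs_ppTrueNumeratorDu_far_le_abs hβ hΛ hu e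
  have hsech : sech (β * u / 2) ^ 2 ≤ 4 * Real.exp (-(β * |u|)) := by
    have h1 : sech (β * u / 2) = sech (β * |u| / 2) := by
      rcases le_or_gt 0 u with h0 | h0
      · rw [abs_of_nonneg h0]
      · rw [abs_of_neg h0, show β * -u / 2 = -(β * u / 2) by ring, sech_neg]
    rw [h1, show β * |u| / 2 = β * |u| / 2 by rfl]
    have := sech_half_sq_le_four_exp_neg (y := β * |u|) (by positivity)
    rwa [show β * |u| / 2 = β * |u| / 2 by rfl] at this
  have hxe : β * |u| * Real.exp (-(β * |u|)) ≤ 1 := by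
    have h1 : β * |u| ≤ Real.exp (β * |u|) := by linarith [Real.add_one_le_exp (β * |u|)]
    calc β * |u| * Real.exp (-(β * |u|)) ≤ Real.exp (β * |u|) * Real.exp (-(β * |u|)) := mul_le_mul_of_nonneg_right h1 (Real.exp_pos _).le
      _ = 1 := by rw [← Real.exp_add, add_neg_cancel, Real.exp_zero]
  have hA : β / 4 * sech (β * u / 2) ^ 2 ≤ 1 / |u| := by
    rw [le_div_iff₀ hu0]
    calc β / 4 * sech (β * u / 2) ^ 2 * |u| ≤ β / 4 * (4 * Real.exp (-(β * |u|))) * |u| := by gcongr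
      _ = β * |u| * Real.exp (-(β * |u|)) := by ring
      _ ≤ 1 := hxe
  have hB : Λ / u ^ 2 ≤ 1 / |u| := by
    rw [← sq_abs, div_le_div_iff₀ (by positivity) hu0]
    nlinarith
  calc |ppTrueNumeratorDu β Λ e u| ≤ β / 4 * sech (β * u / 2) ^ 2 + Λ / u ^ 2 := h
    _ ≤ 1 / |u| + 1 / |u| := add_le_add hA hB
    _ = 2 / |u| := by ring

/-- **Gradient against a scale `M ≤ 2|v|`**: `|∂ᵤN(e,v)| ≤ (12B₁+9)/M` (far levels by `2/|v| ≤ 4/M`, near levels `|v| ≤ Λ` by the uniform bound and `M ≤ 2Λ`).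
[cite: BenfattoGiulianiMastropietro2006, §2.4 (2.36)] -/
theorem abs_ppTrueNumeratorDu_le_of_scale {β Λ : ℝ} (hβ : 0 < β) (hΛ : 0 < Λ) {B₁ : ℝ} (hB₁ : ∀ x, |deriv salmhoferCutoff x| ≤ B₁) {M v : ℝ} (hM : 0 < M)
    (hMv : M ≤ 2 * |v|) (e : ℝ) : |ppTrueNumeratorDu β Λ e v| ≤ (12 * B₁ + 9) / M := by
  have hB0 := salmhoferB₁_nonneg hB₁
  rcases le_or_gt |v| Λ with hnear | hfar
  · have h := abs_ppTrueNumeratorDu_le_unif hβ hΛ hB₁ e v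
    have hMΛ : M ≤ 2 * Λ := hMv.trans (by linarith)
    calc |ppTrueNumeratorDu β Λ e v| ≤ (6 * B₁ + 5 / 2) / Λ := h
      _ ≤ (12 * B₁ + 5) / M := by rw [div_le_div_iff₀ hΛ hM]; nlinarith
      _ ≤ (12 * B₁ + 9) / M := div_le_div_of_nonneg_right (by linarith) hM.le
  · have h := abs_ppTrueNumeratorDu_le_two_div_abs hβ hΛ hfar e
    have hv0 : 0 < |v| := hΛ.trans hfar
    calc |ppTrueNumeratorDu β Λ e v| ≤ 2 / |v| := h
      _ ≤ 4 / M := by rw [div_le_div_iff₀ hv0 hM]; nlinarith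
      _ ≤ (12 * B₁ + 9) / M := div_le_div_of_nonneg_right (by nlinarith) hM.le

/-! ## §4 The signed value envelope -/

/-- **THE VALUE ENVELOPE FOR ALL SIGNED PARTNER LEVELS.**  `0 < β`, `0 < Λ`, `|χ′| ≤ B₁`, `0 < e`: for every `u ∈ ℝ`,
`|N(e,u)/(e+u)| ≤ (12B₁+9)·(max e |u|)⁻¹` (no split needed for `hK0`). [cite: BenfattoGiulianiMastropietro2006, §2.4 (2.36)] -/
theorem abs_trueKernel_signed_le_inv_max {β Λ : ℝ} (hβ : 0 < β) (hΛ : 0 < Λ) {B₁ : ℝ} (hB₁ : ∀ x, |deriv salmhoferCutoff x| ≤ B₁) {e : ℝ} (he : 0 < e)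
    (u : ℝ) : |ppTrueNumerator β Λ e u / (e + u)| ≤ (12 * B₁ + 9) * (max e |u|)⁻¹ := by
  have hB0 := salmhoferB₁_nonneg hB₁
  set M : ℝ := max e |u| with hM
  have hMe : e ≤ M := le_max_left _ _
  have hMu : |u| ≤ M := le_max_right _ _
  have hM0 : 0 < M := he.trans_le hMe
  have hN1 := abs_ppTrueNumerator_le_one hβ Λ e u
  have hC9 : (2 : ℝ) ≤ 12 * B₁ + 9 := by linarith
  by_cases hbig : M / 2 ≤ |e + u|
  · -- `|e+u| ≥ M/2`: `|K| ≤ 1/|e+u| ≤ 2/M`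
    have hs0 : 0 < |e + u| := (by positivity : (0 : ℝ) < M / 2).trans_le hbig
    rw [abs_div]
    calc |ppTrueNumerator β Λ e u| / |e + u| ≤ 1 / (M / 2) := by
          rw [div_le_div_iff₀ hs0 (by positivity)]; nlinarith [abs_nonneg (ppTrueNumerator β Λ e u)]
      _ = 2 * M⁻¹ := by field_simp
      _ ≤ (12 * B₁ + 9) * M⁻¹ := mul_le_mul_of_nonneg_right hC9 (inv_nonneg.2 hM0.le)
  · -- `|e+u| < M/2`: the segment from `−e` to `u` consists of negative levels `|v| > M/2`
    have hsmall : |e + u| < M / 2 := not_le.1 hbig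
    have hseg : ∀ v ∈ uIcc (-e) u, M ≤ 2 * |v| := fun v hv => by
      -- both endpoints are `≤ −M/2`
      have h1 : e + u < M / 2 := (le_abs_self _).trans_lt hsmall
      have h2 : -(M / 2) < e + u := by linarith [neg_abs_le (e + u)]
      have hends : u ≤ -(M / 2) ∧ -e ≤ -(M / 2) := by
        rcases le_total e |u| with h | h
        · have hMu' : M = |u| := by rw [hM, max_eq_right h]
          have hun : u < 0 := by
            by_contra hnn
            rw [abs_of_nonneg (not_lt.1 hnn)] at hMu'
            linarith
          rw [abs_of_neg hun] at hMu'
          constructor <;> linarith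
        · have hMe' : M = e := by rw [hM, max_eq_left h]
          constructor <;> linarith
      have hvle : v ≤ -(M / 2) := by
        rcases mem_uIcc.1 hv with ⟨_, h3⟩ | ⟨_, h3⟩
        · exact h3.trans hends.1
        · exact h3.trans hends.2
      rw [abs_of_neg (by linarith)]
      linarith
    -- mean value from `N(e,−e) = 0`
    have hMVT : ‖ppTrueNumerator β Λ e u - ppTrueNumerator β Λ e (-e)‖ ≤ (12 * B₁ + 9) / M * ‖u - -e‖ :=
      Convex.norm_image_sub_le_of_norm_hasDerivWithin_le (f := fun v => ppTrueNumerator β Λ e v) (f' := fun v => ppTrueNumeratorDu β Λ e v)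
        (s := uIcc (-e) u) (fun v _ => (hasDerivAt_ppTrueNumerator_u hβ hΛ hB₁ e v).hasDerivWithinAt)
        (fun v hv => by rw [Real.norm_eq_abs]; exact abs_ppTrueNumeratorDu_le_of_scale hβ hΛ hB₁ hM0 (hseg v hv) e)
        (convex_uIcc _ _) left_mem_uIcc right_mem_uIcc
    rw [ppTrueNumerator_antidiag, sub_zero, Real.norm_eq_abs, Real.norm_eq_abs, sub_neg_eq_add, add_comm u e] at hMVT
    -- divide by `|e+u|`
    rcases eq_or_ne (e + u) 0 with h0 | h0
    · rw [h0, div_zero, abs_zero]; positivity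
    · have hs0 : 0 < |e + u| := abs_pos.2 h0
      rw [abs_div, div_le_iff₀ hs0]
      calc |ppTrueNumerator β Λ e u| ≤ (12 * B₁ + 9) / M * |e + u| := hMVT
        _ = (12 * B₁ + 9) * M⁻¹ * |e + u| := by rw [div_eq_mul_inv]

end Summit.HubbardSuperconductivity.HubbardSuperconductivity.Theorems.C4a

end
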